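import Mathlib
import HarnessLib
import Literature.Analysis.FluidPDE.VectorCalculus
import Literature.Analysis.FluidPDE.VorticityCalculus
import Literature.Analysis.FluidPDE.WholeSpaceIBP
import Literature.Analysis.FluidPDE.SverakLandauConformalCalc
import Literature.Analysis.FluidPDE.PineauVicolWeightPositivity
import Summits.NavierStokesRegularity.NavierStokesRegularity.Theorems.UnthreadedDoorAntidynamoLambRadial

/-!
# Route `UnthreadedDoor` / `ThreadingFlux`, crux `PoloidalLiouville` (stmt-NavierStokesRegularity-1222), antidynamo v2 skeleton
# (sha16 `4ebf5683127b`), rung `stub_singleDegreeRung`, EVEN degree — input (E1/E2): CURL AND DIVERGENCE OF THE SINGLE-DEGREE FIELD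

Support file (seat leafhand-ns-unthreadeddoor-1 g1, cell decomp-ns), `--supports stmt-NavierStokesRegularity-1222 --as helper`; theorems only.

The decomposition (E1) of the even-degree repair census writes a slice as `V = (a(r) P) • y + k(r) • ∇P + c` (`r = ‖y‖`, `P` a solid
harmonic of degree `l`).  This file computes, off the centre,

* `curl_singleDegreeField` — `curl V = (a(r) − k′(r)/r) • (∇P × y)`  (so `curl V = G • Λ` iff `G = a − k′/r`);
* `divergence_singleDegreeField` — `div V = (r a′(r) + (l + 3) a(r) + l k′(r)/r) P`  (so `div V = 0` iff `r a′ + (l+3) a + l k′/r = 0`,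
  the constitutive ODE of the census), using the Euler identity `⟪∇P, y⟫ = l P` and `ΔP = 0`.

HONEST LABEL: calculus input for the open even-degree rung; nothing here proves the rung, the wall, `PoloidalLiouville` (1222), or bears on
Navier–Stokes regularity. [folklore]
-/

noncomputable section

-- the summit and its single sub-problem share the name (CONVENTIONS §1)
set_option linter.dupNamespace false

open scoped Topology InnerProductSpace RealInnerProductSpace ContDiff Laplacian
open Filter Set Function Metric
open Literature.Analysis.FluidPDE

namespace Summit.NavierStokesRegularity.NavierStokesRegularity.Theorems.PoloidalLiouville.Antidynamo

/-- **CURL OF THE SINGLE-DEGREE FIELD**: for `P ∈ C²`, `x ≠ 0` and radial profiles `a, k` differentiable at `‖x‖`,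
`curl ((a(r)P) • id + k(r) • ∇P)(x) = (a(‖x‖) − k′(‖x‖)/‖x‖) • (∇P(x) × x)`. [folklore] -/
theorem curl_singleDegreeField {a k : ℝ → ℝ} {P : EuclideanSpace ℝ (Fin 3) → ℝ} (hP : ContDiff ℝ 2 P)
    {x : EuclideanSpace ℝ (Fin 3)} (hx : x ≠ 0) (ha : DifferentiableAt ℝ a ‖x‖) (hk : DifferentiableAt ℝ k ‖x‖) :
    curl (fun z : EuclideanSpace ℝ (Fin 3) => (a ‖z‖ * P z) • z + k ‖z‖ • gradient P z) x =
      (a ‖x‖ - deriv k ‖x‖ / ‖x‖) • cross (gradient P x) x := by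
  have hn : DifferentiableAt ℝ (fun z : EuclideanSpace ℝ (Fin 3) => ‖z‖) x :=
    (contDiffAt_norm ℝ hx (n := 1)).differentiableAt (by simp)
  have hPd : DifferentiableAt ℝ P x := (hP.differentiable (by norm_num)) x
  have hgP : DifferentiableAt ℝ (gradient P) x := (differentiable_gradient_of_contDiff_two hP) x
  have haP : DifferentiableAt ℝ (fun z : EuclideanSpace ℝ (Fin 3) => a ‖z‖ * P z) x := (ha.comp x hn).mul hPd
  have hk' : DifferentiableAt ℝ (fun z : EuclideanSpace ℝ (Fin 3) => k ‖z‖) x := hk.comp x hn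
  have hf1 : DifferentiableAt ℝ (fun z : EuclideanSpace ℝ (Fin 3) => (a ‖z‖ * P z) • z) x := haP.smul differentiableAt_id
  have hf2 : DifferentiableAt ℝ (fun z : EuclideanSpace ℝ (Fin 3) => k ‖z‖ • gradient P z) x := hk'.smul hgP
  rw [curl_add hf1 hf2, curl_smul_id_eq_cross_gradient haP, curl_smul_gradient_eq_cross hk' hP,
    gradient_radial_mul hx ha hPd, gradient_radial hx hk, ← crossCLM_apply, ← crossCLM_apply, map_add, map_smul, map_smul,
    map_smul]
  simp only [_root_.add_apply, _root_.smul_apply, crossCLM_apply]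
  have h0 : cross x x = 0 := by simpa using cross_smul_self_left 1 x
  rw [h0, smul_zero, add_zero, cross_swap x (gradient P x), smul_neg, sub_smul]
  abel

/-- **DIVERGENCE OF THE SINGLE-DEGREE FIELD**: for a harmonic `P ∈ C²` with the Euler identity `⟪∇P(z), z⟫ = l P(z)`, `x ≠ 0` and radial
profiles `a, k` differentiable at `‖x‖`,
`div ((a(r)P) • id + k(r) • ∇P)(x) = (‖x‖ a′(‖x‖) + (l + 3) a(‖x‖) + l k′(‖x‖)/‖x‖) P(x)`. [folklore] -/
theorem divergence_singleDegreeField {a k : ℝ → ℝ} {P : EuclideanSpace ℝ (Fin 3) → ℝ} (hP : ContDiff ℝ 2 P) {l : ℝ}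
    (hEuler : ∀ z : EuclideanSpace ℝ (Fin 3), ⟪gradient P z, z⟫ = l * P z)
    (hharm : ∀ z : EuclideanSpace ℝ (Fin 3), (Δ P) z = 0)
    {x : EuclideanSpace ℝ (Fin 3)} (hx : x ≠ 0) (ha : DifferentiableAt ℝ a ‖x‖) (hk : DifferentiableAt ℝ k ‖x‖) :
    VectorCalculus.divergence (fun z : EuclideanSpace ℝ (Fin 3) => (a ‖z‖ * P z) • z + k ‖z‖ • gradient P z) x =
      (‖x‖ * deriv a ‖x‖ + (l + 3) * a ‖x‖ + l * deriv k ‖x‖ / ‖x‖) * P x := by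
  have hn : DifferentiableAt ℝ (fun z : EuclideanSpace ℝ (Fin 3) => ‖z‖) x :=
    (contDiffAt_norm ℝ hx (n := 1)).differentiableAt (by simp)
  have hPd : DifferentiableAt ℝ P x := (hP.differentiable (by norm_num)) x
  have hgP : DifferentiableAt ℝ (gradient P) x := (differentiable_gradient_of_contDiff_two hP) x
  have haP : DifferentiableAt ℝ (fun z : EuclideanSpace ℝ (Fin 3) => a ‖z‖ * P z) x := (ha.comp x hn).mul hPd
  have hk' : DifferentiableAt ℝ (fun z : EuclideanSpace ℝ (Fin 3) => k ‖z‖) x := hk.comp x hn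
  have hf1 : DifferentiableAt ℝ (fun z : EuclideanSpace ℝ (Fin 3) => (a ‖z‖ * P z) • z) x := haP.smul differentiableAt_id
  have hf2 : DifferentiableAt ℝ (fun z : EuclideanSpace ℝ (Fin 3) => k ‖z‖ • gradient P z) x := hk'.smul hgP
  -- `div (f + g) = div f + div g`
  have hadd : VectorCalculus.divergence (fun z : EuclideanSpace ℝ (Fin 3) => (a ‖z‖ * P z) • z + k ‖z‖ • gradient P z) x =
      VectorCalculus.divergence (fun z : EuclideanSpace ℝ (Fin 3) => (a ‖z‖ * P z) • z) x +
        VectorCalculus.divergence (fun z : EuclideanSpace ℝ (Fin 3) => k ‖z‖ • gradient P z) x := by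
    simp only [VectorCalculus.divergence]
    rw [fderiv_fun_add hf1 hf2, ContinuousLinearMap.toLinearMap_add, map_add]
  have hid : VectorCalculus.divergence (id : EuclideanSpace ℝ (Fin 3) → EuclideanSpace ℝ (Fin 3)) x = 3 :=
    Sverak2011.divergence_id_three x
  rw [hadd, show (fun z : EuclideanSpace ℝ (Fin 3) => (a ‖z‖ * P z) • z) =
      fun z => (a ‖z‖ * P z) • id z from rfl,
    divergence_smul_apply haP differentiableAt_id, divergence_smul_apply hk' hgP, hid,
    PineauVicol2026.divergence_gradient hP, hharm x, gradient_radial_mul hx ha hPd, gradient_radial hx hk, id]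
  rw [inner_add_right, inner_smul_right, inner_smul_right, inner_smul_right, real_inner_self_eq_norm_sq,
    real_inner_comm, hEuler x]
  have hr : ‖x‖ ≠ 0 := norm_ne_zero_iff.2 hx
  field_simp
  ring

end Summit.NavierStokesRegularity.NavierStokesRegularity.Theorems.PoloidalLiouville.Antidynamo

end
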